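import Summits.QuantumFields.YangMills.Theorems.UnitScaleTiltProp7CombTildRem2OfRegPrT3
import Summits.QuantumFields.YangMills.Theorems.UnitScaleTiltProp7CombTildLinearResponseOfRegPrT3
import Summits.QuantumFields.YangMills.Theorems.UnitScaleTiltProp7CombFrameRem2OfRegPrT3
import HarnessLib

/-!
# Route `UnitScaleTilt`, crux K1 «MinimiserStabilityRegPr» (stmt-QuantumFields-19200), route-R E′ (A′)-on-Σ, P-A2 (β), row `hMcomb₂` ⟸ H2-1 — file H-3c (member)
# «`hMcomb₂` ⟸ THE `ℓ¹` ROW OF THE SECOND-ORDER DEFECT `E`»: px13 g6's SIGNATURE-0′ `hMcomb₂` summand IS `E_l(ẑ, κ) = (Ũˡ(ẑ,κ) − 1) − Q l (iX)♯ ẑ κ` (★routeR-w2 g10's (hcomb) over H-1),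
# so **`hMcomb₂` follows from ONE displayed row H2-1(E): `∀ l < K − n, Σ_{ẑ ∈ cell_l}Σ_κ ‖E_l(ẑ,κ)‖ ≤ Am₂(Lˡ)⁻¹ + Bm₂Lˡ`**, where `E` obeys H-3b's recursion with two-block sources — its windows now
# ALL discharged at `RegPr` (★routeR-w2 g10's (hW) drops `hW64`)

Cell `ym3-torus` (HUMAN RULING D-0037: YM₃ on the torus is ladder rung R3 — not d = 4, not a mass gap, not Clay), width seat `ym3-torus-px17` (gen 4); ★★OWNER RULINGS №20 (1) (`hMcomb₂`),
№22 (c); ★routeR-w1 g9 07:08:36Z.  `--supports stmt-QuantumFields-19200 --as helper`; THEOREMS ONLY (0 `def`, 0 `sorry`); count-neutral.  «route-internal row (n3)-comb₂ — NOT N06,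
NOT a print row; OPEN».  Nothing of `hMcomb`, `hMcomb₂`, H2-1, (β), `hPA2`, `hcoS`, E′, EX, the crux, d = 4 or the gap is claimed.

THE POINT.  Three landed∕signed inputs meet: (i) H-3b ✓`Prop7CombTildRem2OfRegPrT3.norm_rem2_succ_sub_trueStep_le_of_regPr` (the recursion `‖E_{l+1}(z,κ) − T_l(E_l)(L•z,κ)‖ ≤
260·((2d+2)L)²·M₂,l(z,κ)` at `RegPr`, displaying only the background-loop row `hW64`); (ii) ★routeR-w2 g10's ✓`Prop7CombTildLinearResponseOfRegPr.norm_Wcx_avgIter_sub_one_le_of_regPr`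
(= `hW64` at `RegPr`, `10⁷L³ε₀ ≤ 1`) and ✓`fderiv_coe_tildIter_eq_linTower_of_regPr` ((hcomb): `fderiv ℂ (A′ ↦ ↑Ũˡ[(e^{A′})♯](z,κ)) 0 A = Q l (A♯) z κ`, over H-1); (iii) px13 g6's
SIGNATURE-0′ text (as displayed by ✓`Prop7CombFrameRem2OfRegPrT3.sum_norm_frameTw_sub_one_sub_fderiv_le_of_regPr`, the REM2ᶜ consumer).  So: §1 the recursion with NO kinematic row
displayed; §2 ★★★ `hMcomb₂_of_rem2L1` — the SIGNATURE-0′ row `hMcomb₂` (free reals `Am₂ Bm₂`, at `A := iX`) follows from the `ℓ¹` row of `E` over the level-`l` period cells, TOKEN FOR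
TOKEN.  What remains OPEN is exactly H2-1(E) — the `ℓ¹` stability of the inhomogeneous linearised cornered tower with sources dominated by the two-block masses of `Ũˡ − 1` (whose cell
sums are `hMcomb`'s currency): px18 g4's FLAT KNIT (✓p705643∕✓p706697 devices) + ★routeR-w1's F-5c∕F-6 dressing.

WHAT IS PROVED (ns `…Theorems.Prop7CombTildRem2HMcomb2T3`): ★★ `norm_rem2_succ_sub_trueStep_le_of_regPr'` (§1), ★★★ `hMcomb₂_of_rem2L1` (§2).
HONEST SCOPE.  Two `exact`∕`rw` assemblies; no estimate of `E`; H2-1 OPEN.  Rung R3, not Clay; YM gap NOT proved.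

References: T. Bałaban, CMP **98** (1985) 17–51 [Balaban1985Averaging] ((42) p.23, (65)∕(68)∕(69) p.29, Prop. 3 (113)–(126) pp.34–36, (159)–(163) p.42); CMP **99** (1985) 75–102
[Balaban1985RegularSpaces] (Prop. 7 (1.139)–(1.141) p.100); CMP **102** (1985) 277–309 [Balaban1985Variational] ((19) p.281, (44) p.285); CMP **109** (1987) 249–301
[Balaban1987RG1] ((0.4) p.253).
-/

set_option autoImplicit false

noncomputable section

open scoped BigOperators Matrix.Norms.L2Operator

namespace Summit.QuantumFields.YangMills.Theorems.Prop7CombTildRem2HMcomb2T3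

open NormedSpace
open Literature.MathematicalPhysics.QuantumFieldTheory.Balaban1983to89
open Literature.MathematicalPhysics.QuantumFieldTheory.Balaban1983to89.T3ContinuumYM3Torus
open T4Continuum BlockAveraging
open T3PrintedRegularMinimiser (RegPr)
open T3SectALandauChart (bgUnits)
open ExpMeanLog (eml)
open B7Prop1Explicit renaming Site → LSite
open B7Prop1Explicit (e seg boxVec gammaWord Wcx Xavg expUnit)
open B7Prop2Explicit (avgIter)
open B7Prop3Flat (expCfg)
open B7Eq92Concrete (tildIter)
open B7Prop3GeneralRotated (tsum)
open B10Eq27TorusAxialLog (pull transl)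
open Summit.QuantumFields.YangMills.Theorems.Prop7SPrint (basePt)
open Summit.QuantumFields.YangMills.Theorems.Prop7TPrint (nMax19)
open Summit.QuantumFields.YangMills.Theorems.Prop7SymAvgTwFrameDiff (pull_expUnit_eq_expCfg)
open Summit.QuantumFields.YangMills.Theorems.Prop7CombTildRem2OfRegPrT3 (norm_rem2_succ_sub_trueStep_le_of_regPr)
open Summit.QuantumFields.YangMills.Theorems.Prop7CombFrameRem2OfRegPrT3 (window_ten7_cube_of_four)
open Summit.QuantumFields.YangMills.Theorems.Prop7CombTildLinearResponseOfRegPr (norm_Wcx_avgIter_sub_one_le_of_regPr fderiv_coe_tildIter_eq_linTower_of_regPr)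

section Member

variable (F : T3Family) {n K : ℕ}


/-- ★★ **H-3b WITH NO KINEMATIC ROW DISPLAYED**: the second-order defect recursion of print's single bars at a printed-regular background, the background-loop row `hW64` discharged by
★routeR-w2 g10's ✓`norm_Wcx_avgIter_sub_one_le_of_regPr`. [cite: Balaban1985Averaging, (65)-(69) p.29, (42)-(44) pp.23-24, Prop. 3 (113)-(126) pp.34-36, (159)-(163) p.42; Balaban1985RegularSpaces, Prop. 7 (1.139)-(1.141) p.100; Balaban1985Variational, (19) p.281] -/
theorem norm_rem2_succ_sub_trueStep_le_of_regPr' {ε₀ : ℝ} (hε₀ : 0 < ε₀) (hε : 10 ^ 7 * (F.L : ℝ) ^ 4 * ε₀ ≤ 1)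
    (W : GaugeField (F.P K) 0 (Matrix.specialUnitaryGroup (Fin 2) ℂ)) (hreg : RegPr F n K ε₀ W)
    (X : PBond (F.P K) 0 → Matrix (Fin 2) (Fin 2) ℂ) (hX : ∀ b, (X b).IsHermitian ∧ (X b).trace = 0) (hX6 : nMax19 F n K W X < ε₀ / 6)
    (Q : ℕ → (LSite (F.P K).d → Fin (F.P K).d → Matrix (Fin 2) (Fin 2) ℂ) → LSite (F.P K).d → Fin (F.P K).d → Matrix (Fin 2) (Fin 2) ℂ)
    (hQs : ∀ (k : ℕ) (Y : LSite (F.P K).d → Fin (F.P K).d → Matrix (Fin 2) (Fin 2) ℂ) (z : LSite (F.P K).d) (κ : Fin (F.P K).d),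
      letI : CStarAlgebra (Matrix (Fin 2) (Fin 2) ℂ) := B10Eq29TubeLine.cstarAlgebraMatrix 2
      Q (k + 1) Y z κ
        = fderiv ℂ (eml : ((Fin (F.P K).d → Fin (F.P K).L) → Matrix (Fin 2) (Fin 2) ℂ) → Matrix (Fin 2) (Fin 2) ℂ)
              (fun r => ((Wcx (F.P K).L (avgIter (F.P K).L (pull (bgUnits F K W) (basePt F n K)) k) (((F.P K).L : ℤ) • z) κ (boxVec (F.P K).L r) :
                (Matrix (Fin 2) (Fin 2) ℂ)ˣ) : Matrix (Fin 2) (Fin 2) ℂ))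
              (fun r => tsum (avgIter (F.P K).L (pull (bgUnits F K W) (basePt F n K)) k) (Q k Y) (((F.P K).L : ℤ) • z)
                  (gammaWord (F.P K).L κ (boxVec (F.P K).L r) ++ seg κ (-((F.P K).L : ℤ)))
                * ((Wcx (F.P K).L (avgIter (F.P K).L (pull (bgUnits F K W) (basePt F n K)) k) (((F.P K).L : ℤ) • z) κ (boxVec (F.P K).L r) :
                    (Matrix (Fin 2) (Fin 2) ℂ)ˣ) : Matrix (Fin 2) (Fin 2) ℂ))
              * (((expUnit (Xavg (F.P K).L (avgIter (F.P K).L (pull (bgUnits F K W) (basePt F n K)) k) (((F.P K).L : ℤ) • z) κ))⁻¹ :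
                  (Matrix (Fin 2) (Fin 2) ℂ)ˣ) : Matrix (Fin 2) (Fin 2) ℂ)
            + ((expUnit (Xavg (F.P K).L (avgIter (F.P K).L (pull (bgUnits F K W) (basePt F n K)) k) (((F.P K).L : ℤ) • z) κ) : (Matrix (Fin 2) (Fin 2) ℂ)ˣ) :
                  Matrix (Fin 2) (Fin 2) ℂ)
                * tsum (avgIter (F.P K).L (pull (bgUnits F K W) (basePt F n K)) k) (Q k Y) (((F.P K).L : ℤ) • z) (seg κ ((F.P K).L : ℤ))
              * (((expUnit (Xavg (F.P K).L (avgIter (F.P K).L (pull (bgUnits F K W) (basePt F n K)) k) (((F.P K).L : ℤ) • z) κ))⁻¹ :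
                  (Matrix (Fin 2) (Fin 2) ℂ)ˣ) : Matrix (Fin 2) (Fin 2) ℂ))
    {l : ℕ} (hl : l < K - n) (z : LSite (F.P K).d) (κ : Fin (F.P K).d) :
    letI : CStarAlgebra (Matrix (Fin 2) (Fin 2) ℂ) := B10Eq29TubeLine.cstarAlgebraMatrix 2
    ‖(((tildIter (F.P K).L (pull (bgUnits F K W) (basePt F n K)) (expCfg fun x μ => Complex.I • X ⟨transl (basePt F n K) x, μ⟩) (l + 1) z κ :
            (Matrix (Fin 2) (Fin 2) ℂ)ˣ) : Matrix (Fin 2) (Fin 2) ℂ) - 1 - Q (l + 1) (fun x μ => Complex.I • X ⟨transl (basePt F n K) x, μ⟩) z κ)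
        - (fderiv ℂ (eml : ((Fin (F.P K).d → Fin (F.P K).L) → Matrix (Fin 2) (Fin 2) ℂ) → Matrix (Fin 2) (Fin 2) ℂ)
              (fun r => ((Wcx (F.P K).L (avgIter (F.P K).L (pull (bgUnits F K W) (basePt F n K)) l) (((F.P K).L : ℤ) • z) κ (boxVec (F.P K).L r) :
                (Matrix (Fin 2) (Fin 2) ℂ)ˣ) : Matrix (Fin 2) (Fin 2) ℂ))
              (fun r => tsum (avgIter (F.P K).L (pull (bgUnits F K W) (basePt F n K)) l)
                  ((fun x μ => ((tildIter (F.P K).L (pull (bgUnits F K W) (basePt F n K)) (expCfg fun x μ => Complex.I • X ⟨transl (basePt F n K) x, μ⟩) l x μ :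
                      (Matrix (Fin 2) (Fin 2) ℂ)ˣ) : Matrix (Fin 2) (Fin 2) ℂ) - 1)
                    - Q l (fun x μ => Complex.I • X ⟨transl (basePt F n K) x, μ⟩))
                  (((F.P K).L : ℤ) • z) (gammaWord (F.P K).L κ (boxVec (F.P K).L r) ++ seg κ (-((F.P K).L : ℤ)))
                * ((Wcx (F.P K).L (avgIter (F.P K).L (pull (bgUnits F K W) (basePt F n K)) l) (((F.P K).L : ℤ) • z) κ (boxVec (F.P K).L r) :
                    (Matrix (Fin 2) (Fin 2) ℂ)ˣ) : Matrix (Fin 2) (Fin 2) ℂ))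
              * (((expUnit (Xavg (F.P K).L (avgIter (F.P K).L (pull (bgUnits F K W) (basePt F n K)) l) (((F.P K).L : ℤ) • z) κ))⁻¹ :
                  (Matrix (Fin 2) (Fin 2) ℂ)ˣ) : Matrix (Fin 2) (Fin 2) ℂ)
            + ((expUnit (Xavg (F.P K).L (avgIter (F.P K).L (pull (bgUnits F K W) (basePt F n K)) l) (((F.P K).L : ℤ) • z) κ) : (Matrix (Fin 2) (Fin 2) ℂ)ˣ) :
                  Matrix (Fin 2) (Fin 2) ℂ)
                * tsum (avgIter (F.P K).L (pull (bgUnits F K W) (basePt F n K)) l)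
                  ((fun x μ => ((tildIter (F.P K).L (pull (bgUnits F K W) (basePt F n K)) (expCfg fun x μ => Complex.I • X ⟨transl (basePt F n K) x, μ⟩) l x μ :
                      (Matrix (Fin 2) (Fin 2) ℂ)ˣ) : Matrix (Fin 2) (Fin 2) ℂ) - 1)
                    - Q l (fun x μ => Complex.I • X ⟨transl (basePt F n K) x, μ⟩))
                  (((F.P K).L : ℤ) • z) (seg κ ((F.P K).L : ℤ))
              * (((expUnit (Xavg (F.P K).L (avgIter (F.P K).L (pull (bgUnits F K W) (basePt F n K)) l) (((F.P K).L : ℤ) • z) κ))⁻¹ :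
                  (Matrix (Fin 2) (Fin 2) ℂ)ˣ) : Matrix (Fin 2) (Fin 2) ℂ))‖
      ≤ 260 * (((2 * ((F.P K).d : ℝ) + 2) * ((F.P K).L : ℝ)) ^ 2
          * ∑ s : Fin (F.P K).d → Fin (F.P K).L, ∑ ν : Fin (F.P K).d,
            (‖((tildIter (F.P K).L (pull (bgUnits F K W) (basePt F n K)) (expCfg fun x μ => Complex.I • X ⟨transl (basePt F n K) x, μ⟩) l
                  (((F.P K).L : ℤ) • z + boxVec (F.P K).L s) ν : (Matrix (Fin 2) (Fin 2) ℂ)ˣ) : Matrix (Fin 2) (Fin 2) ℂ) - 1‖ ^ 2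
              + ‖((tildIter (F.P K).L (pull (bgUnits F K W) (basePt F n K)) (expCfg fun x μ => Complex.I • X ⟨transl (basePt F n K) x, μ⟩) l
                  (((F.P K).L : ℤ) • z + ((F.P K).L : ℤ) • e κ + boxVec (F.P K).L s) ν : (Matrix (Fin 2) (Fin 2) ℂ)ˣ) : Matrix (Fin 2) (Fin 2) ℂ) - 1‖ ^ 2)) :=
  norm_rem2_succ_sub_trueStep_le_of_regPr F hε₀ hε W hreg X hX hX6
    (fun _ hk q κ' r => norm_Wcx_avgIter_sub_one_le_of_regPr F hε₀ (window_ten7_cube_of_four F hε₀.le hε) W hreg hk q κ' r) Q hQs hl z κ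

/-- ★★★ **`hMcomb₂` ⟸ THE `ℓ¹` ROW OF THE SECOND-ORDER DEFECT `E`**: at a printed-regular background (`10⁷L⁴ε₀ ≤ 1`), for ANY family `Q` with ★routeR-w1's linearised-tower texts `hQ0`∕`hQs`
at the member letters, IF `∀ l < K − n, Σ_{ẑ : Site (F.P K) l}Σ_κ ‖(↑Ũˡ(ẑ,κ) − 1) − Q l (iX)♯ ẑ κ‖ ≤ Am₂(Lˡ)⁻¹ + Bm₂Lˡ` (H2-1(E), OPEN), THEN px13 g6's SIGNATURE-0′ row `hMcomb₂` at `A := iX` holds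
TOKEN FOR TOKEN (★routeR-w2 g10's (hcomb) ∘ H-1: the Fréchet derivative IS `Q l (iX)♯`; ✓`pull_expUnit_eq_expCfg`: `(e^{iX})♯ = expCfg (iX)♯`).
[cite: Balaban1985Averaging, (65)-(69) p.29, (119) p.35; Balaban1987RG1, (0.4) p.253] -/
theorem hMcomb₂_of_rem2L1 {ε₀ : ℝ} (hε₀ : 0 < ε₀) (hε : 10 ^ 7 * (F.L : ℝ) ^ 4 * ε₀ ≤ 1)
    (W : GaugeField (F.P K) 0 (Matrix.specialUnitaryGroup (Fin 2) ℂ)) (hreg : RegPr F n K ε₀ W) (X : PBond (F.P K) 0 → Matrix (Fin 2) (Fin 2) ℂ)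
    (Q : ℕ → (LSite (F.P K).d → Fin (F.P K).d → Matrix (Fin 2) (Fin 2) ℂ) → LSite (F.P K).d → Fin (F.P K).d → Matrix (Fin 2) (Fin 2) ℂ) (hQ0 : ∀ Y, Q 0 Y = Y)
    (hQs : ∀ (k : ℕ) (Y : LSite (F.P K).d → Fin (F.P K).d → Matrix (Fin 2) (Fin 2) ℂ) (z : LSite (F.P K).d) (κ : Fin (F.P K).d),
      letI : CStarAlgebra (Matrix (Fin 2) (Fin 2) ℂ) := B10Eq29TubeLine.cstarAlgebraMatrix 2
      Q (k + 1) Y z κ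
        = fderiv ℂ (eml : ((Fin (F.P K).d → Fin (F.P K).L) → Matrix (Fin 2) (Fin 2) ℂ) → Matrix (Fin 2) (Fin 2) ℂ)
              (fun r => ((Wcx (F.P K).L (avgIter (F.P K).L (pull (bgUnits F K W) (basePt F n K)) k) (((F.P K).L : ℤ) • z) κ (boxVec (F.P K).L r) :
                (Matrix (Fin 2) (Fin 2) ℂ)ˣ) : Matrix (Fin 2) (Fin 2) ℂ))
              (fun r => tsum (avgIter (F.P K).L (pull (bgUnits F K W) (basePt F n K)) k) (Q k Y) (((F.P K).L : ℤ) • z)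
                  (gammaWord (F.P K).L κ (boxVec (F.P K).L r) ++ seg κ (-((F.P K).L : ℤ)))
                * ((Wcx (F.P K).L (avgIter (F.P K).L (pull (bgUnits F K W) (basePt F n K)) k) (((F.P K).L : ℤ) • z) κ (boxVec (F.P K).L r) :
                    (Matrix (Fin 2) (Fin 2) ℂ)ˣ) : Matrix (Fin 2) (Fin 2) ℂ))
              * (((expUnit (Xavg (F.P K).L (avgIter (F.P K).L (pull (bgUnits F K W) (basePt F n K)) k) (((F.P K).L : ℤ) • z) κ))⁻¹ :
                  (Matrix (Fin 2) (Fin 2) ℂ)ˣ) : Matrix (Fin 2) (Fin 2) ℂ)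
            + ((expUnit (Xavg (F.P K).L (avgIter (F.P K).L (pull (bgUnits F K W) (basePt F n K)) k) (((F.P K).L : ℤ) • z) κ) : (Matrix (Fin 2) (Fin 2) ℂ)ˣ) :
                  Matrix (Fin 2) (Fin 2) ℂ)
                * tsum (avgIter (F.P K).L (pull (bgUnits F K W) (basePt F n K)) k) (Q k Y) (((F.P K).L : ℤ) • z) (seg κ ((F.P K).L : ℤ))
              * (((expUnit (Xavg (F.P K).L (avgIter (F.P K).L (pull (bgUnits F K W) (basePt F n K)) k) (((F.P K).L : ℤ) • z) κ))⁻¹ :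
                  (Matrix (Fin 2) (Fin 2) ℂ)ˣ) : Matrix (Fin 2) (Fin 2) ℂ))
    {Am₂ Bm₂ : ℝ}
    (hE : ∀ l : ℕ, l < K - n →
      ∑ z : Site (F.P K) l, ∑ κ : Fin (F.P K).d,
        ‖(((tildIter (F.P K).L (pull (bgUnits F K W) (basePt F n K)) (expCfg fun x μ => Complex.I • X ⟨transl (basePt F n K) x, μ⟩) l
              (fun μ => ((z μ).val : ℤ)) κ : (Matrix (Fin 2) (Fin 2) ℂ)ˣ) : Matrix (Fin 2) (Fin 2) ℂ) - 1)
            - Q l (fun x μ => Complex.I • X ⟨transl (basePt F n K) x, μ⟩) (fun μ => ((z μ).val : ℤ)) κ‖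
          ≤ Am₂ * ((F.L : ℝ) ^ l)⁻¹ + Bm₂ * (F.L : ℝ) ^ l) :
    ∀ l : ℕ, l < K - n →
      ∑ z : Site (F.P K) l, ∑ κ : Fin (F.P K).d,
        ‖((tildIter (F.P K).L (pull (bgUnits F K W) (basePt F n K)) (pull (fun b => expUnit ((fun b => Complex.I • X b) b)) (basePt F n K)) l
              (fun μ => ((z μ).val : ℤ)) κ : (Matrix (Fin 2) (Fin 2) ℂ)ˣ) : Matrix (Fin 2) (Fin 2) ℂ) - 1
            - (fderiv ℂ (fun A' : PBond (F.P K) 0 → Matrix (Fin 2) (Fin 2) ℂ =>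
                ((tildIter (F.P K).L (pull (bgUnits F K W) (basePt F n K)) (pull (fun b => expUnit (A' b)) (basePt F n K)) l (fun μ => ((z μ).val : ℤ)) κ :
                  (Matrix (Fin 2) (Fin 2) ℂ)ˣ) : Matrix (Fin 2) (Fin 2) ℂ)) 0) (fun b => Complex.I • X b)‖
          ≤ Am₂ * ((F.L : ℝ) ^ l)⁻¹ + Bm₂ * (F.L : ℝ) ^ l := by
  letI : CStarAlgebra (Matrix (Fin 2) (Fin 2) ℂ) := B10Eq29TubeLine.cstarAlgebraMatrix 2
  have hε3 : 10 ^ 7 * (F.L : ℝ) ^ 3 * ε₀ ≤ 1 := window_ten7_cube_of_four F hε₀.le hε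
  have hpull : pull (fun b => expUnit ((fun b => Complex.I • X b) b)) (basePt F n K)
      = expCfg (fun x μ => Complex.I • X ⟨transl (basePt F n K) x, μ⟩) := pull_expUnit_eq_expCfg F _ _
  intro l hl
  have h := hE l hl
  refine le_of_eq_of_le ?_ h
  refine Finset.sum_congr rfl fun z _ => Finset.sum_congr rfl fun κ _ => ?_
  rw [(fderiv_coe_tildIter_eq_linTower_of_regPr F hε₀ hε3 W hreg Q hQ0 hQs (fun b => Complex.I • X b) hl.le _ κ).2, hpull]

end Member

end Summit.QuantumFields.YangMills.Theorems.Prop7CombTildRem2HMcomb2T3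

end
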